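import Summits.QuantumFields.BalabanUV.T4Continuum.Support.NE7K1LinSchurFoldBox
import Literature.MathematicalPhysics.QuantumFieldTheory.Balaban1983to89.B4TwoBox120

/-!
# NE7K1LinTorusLineInvariant — row NE7 (node U5), candidate route HOM, path H1L, cell K1-lin(s): THE DOUBLED-TORUS TWO-CUTOFF LINE
# IS TRANSLATION-INVARIANT at `a = 0` — `σ_s = (1−s)(−Δ^𝕋) + s·K_L^𝕋` is a convolution operator on `Π_μ ℤ∕2N_μ`, hence HAS A SYMBOL
# (NEEDS-ESTIMATE #E1 «REG-LINE(s)»: the object of B-E1, typed)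

Lineage `b2b-balaban-t4-ne7-p2` (CRUX PROVER NE7 #2), generation 72; file 36.  PRICING-NE7 v28 N-28-1 ∕ v29 N-30-1 (B-E1): the
regularity half of #E1 works with the SYMBOL of `−D_s = (1−s)(−Δ^{η_A}) + s·K_L` («translation-invariant on η_A»); files 30–35
(`NE7K1LinSchurFoldBox.torLine_mul_unfoldM`) reduce the Neumann box EXACTLY to the doubled torus.  THIS FILE proves that the torus
line is indeed translation-invariant — by the SAME algebraic «LEMMA F» (`NE7K1LinSchurFold.lineOpR_intertwine`), now with a
translation in the rôle of the unfold matrix: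

* §1 arithmetic: `ediv_emod_mul` (`(z mod LK)∕L = (z∕L) mod K`), **`blk_wrap`** (block labels of representatives are
  representatives of block labels), `wrap_add_eq_iff'`.
* §2 THE TRANSLATION MATRICES `translM P w F (x,y) = [x + w ≡ y]` on representatives `F = boxDom P` (`translM_mul_apply`,
  `mul_translM_apply`).
* §3 **`tadj_transl`** (the periodised adjacency is translation-invariant) ⇒ **`torOpK_zero_mul_translM`**: at `a = 0` the periodic fine
  operator commutes with every translation.
* §4 **`bsum_mul_translM`** ∕ **`translM_mul_bsum_transpose`**: block sums intertwine the fine translation by `L·v` with the coarse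
  translation by `v`.
* §5 **`torLine_zero_mul_translM`**: at `a = 0`, `torLine(s)·P_v = P_v·torLine(s)` for every coarse translation `v ∈ ℤ^{d+1}` and every
  `s`; **`torLine_zero_transl_apply`**: `T^𝕋(s)(x + v, y + v) = T^𝕋(s)(x, y)` — the line is a CONVOLUTION by the row `T^𝕋(s)(0, ·)`, the
  object whose finite Fourier transform is lens 2's symbol `σ_s = (1−s)NN + s·k̃_L` (B-E1's carrier).

HONEST FRAMING: [folklore]; finite identities; no estimate; `a = 0` only (for `a > 0` the `n`-block averaging breaks the symmetry
down to translations by whole `n`-blocks — not typed, not needed: B-E1's symbol is the `a = 0` object, the averaging term is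
added separately in `(σ_s + aQ^*Q)⁻¹`); nothing of Bałaban's asserted; no `sorry`.  Census only (B-E1's OBJECT typed; B-E1's
CLAUSES — window, strip, floors — untouched); NE7 NOT PRINTED ∕ NOT PROVED; spine 0∕9; FIXED FINITE T⁴, rung (B)+1; NOT infinite
volume, NOT mass gap, NOT Clay.  HONEST DEPENDENCY: continuum YM on T⁴ ⇐ BetaPertH ∧ nine spine estimates (0/9 proved); BetaPertH ⇐
(D1) ∧ (D4) ∧ CAP+tail; G-an2-4 gates asym, D1 and NE2/3/4.
-/

noncomputable section

open Finset Matrix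

namespace Summit.QuantumFields.BalabanUV.T4Continuum.NE7K1LinTorusLineInvariant

open Literature.MathematicalPhysics.QuantumFieldTheory.Balaban1983to89
open Literature.MathematicalPhysics.QuantumFieldTheory.Balaban1983to89.B4Reflection242
open Literature.MathematicalPhysics.QuantumFieldTheory.Balaban1983to89.B4Lower18
open Literature.MathematicalPhysics.QuantumFieldTheory.Balaban1983to89.B4TorusPositivity (wrap wrap_wrap_add)
open Literature.MathematicalPhysics.QuantumFieldTheory.Balaban1983to89.B4TwoBox120 (blk_add_mul)
open NE7K1LinFoldKernels NE7K1LinFoldMatrices NE7K1LinSchurFold NE7K1LinTorusChart NE7K1LinSchurFoldBox NE7K1LinBlockCoords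
  NE7K1LinSchurLineU1 NE7K1LinSchurLineForm

variable {d : ℕ}

/-! ### §1 Arithmetic: block labels of representatives, shifted reductions -/

/-- `(z mod LK)∕L = (z∕L) mod K` (floor division, `L, K > 0`). [folklore] -/
theorem ediv_emod_mul {L K : ℤ} (hL : 0 < L) (hK : 0 < K) (z : ℤ) : z % (L * K) / L = (z / L) % K := by
  have hLK : 0 < L * K := mul_pos hL hK
  set r := z % (L * K) with hr
  set q := z / (L * K) with hq
  have hz : z = r + L * (K * q) := by
    have := Int.mul_ediv_add_emod z (L * K)
    rw [← mul_assoc]; linarith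
  have hr0 : 0 ≤ r := Int.emod_nonneg _ hLK.ne'
  have hr1 : r < L * K := Int.emod_lt_of_pos _ hLK
  have h1 : z / L = r / L + K * q := by rw [hz, Int.add_mul_ediv_left _ _ hL.ne']
  have h2 : 0 ≤ r / L := Int.ediv_nonneg hr0 hL.le
  have h3 : r / L < K := Int.ediv_lt_of_lt_mul hL (by rw [mul_comm]; exact hr1)
  rw [h1, Int.add_mul_emod_self_left, Int.emod_eq_of_lt h2 h3]

/-- **BLOCK LABELS OF REPRESENTATIVES ARE REPRESENTATIVES OF BLOCK LABELS**: `blk_L (z mod L·P) = (blk_L z) mod P`. [folklore] -/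
theorem blk_wrap {L : ℕ} (hL : 1 ≤ L) {P : Fin (d + 1) → ℕ} (hP : ∀ i, 1 ≤ P i) (z : Fin (d + 1) → ℤ) :
    blk L (wrap (fun i => L * P i) z) = wrap P (blk L z) := by
  funext i
  simp only [blk, wrap]
  push_cast
  exact ediv_emod_mul (by exact_mod_cast hL) (by exact_mod_cast hP i) (z i)

/-- `a + w ≡ y (mod P)` iff `a ≡ y − w` (for a representative `y`). [folklore] -/
theorem wrap_add_eq_iff' {P : Fin (d + 1) → ℕ} {a w y : Fin (d + 1) → ℤ} (hy : y ∈ boxDom P) :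
    wrap P (a + w) = y ↔ wrap P a = wrap P (y - w) := by
  constructor
  · intro h
    rw [← h, sub_eq_add_neg, wrap_wrap_add, add_neg_cancel_right]
  · intro h
    rw [← wrap_wrap_add, h, wrap_wrap_add, sub_add_cancel, wrap_eq_self hy]

/-! ### §2 Translation matrices on representatives -/

/-- the TRANSLATION MATRIX by `w` on the representatives `F` (meant `F = boxDom P`): `P_w(x, y) = [x + w ≡ y (mod P)]`. [folklore] -/
def translM (P : Fin (d + 1) → ℕ) (w : Fin (d + 1) → ℤ) (F : Finset (Fin (d + 1) → ℤ)) : Matrix ↥F ↥F ℝ :=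
  Matrix.of fun x y => if wrap P (x.1 + w) = y.1 then 1 else 0

/-- unfolding lemma for `translM`. [folklore] -/
@[simp] theorem translM_apply (P : Fin (d + 1) → ℕ) (w : Fin (d + 1) → ℤ) (F : Finset (Fin (d + 1) → ℤ)) (x y : ↥F) :
    translM P w F x y = if wrap P (x.1 + w) = y.1 then 1 else 0 := rfl

/-- a shifted representative, as an element of the representatives. [folklore] -/
theorem wrap_add_mem {P : Fin (d + 1) → ℕ} (hP : ∀ i, 1 ≤ P i) (x w : Fin (d + 1) → ℤ) : wrap P (x + w) ∈ boxDom P :=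
  wrap_mem_boxDom hP _

/-- `(P_w·X)(x, ·) = X(x + w, ·)`. [folklore] -/
theorem translM_mul_apply {P : Fin (d + 1) → ℕ} (hP : ∀ i, 1 ≤ P i) (w : Fin (d + 1) → ℤ) {κ : Type*}
    (X : Matrix ↥(boxDom P) κ ℝ) (x : ↥(boxDom P)) (z : κ) :
    (translM P w (boxDom P) * X) x z = X ⟨wrap P (x.1 + w), wrap_add_mem hP x.1 w⟩ z := by
  classical
  rw [Matrix.mul_apply, Finset.sum_eq_single ⟨wrap P (x.1 + w), wrap_add_mem hP x.1 w⟩]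
  · simp
  · intro y _ hy
    have : wrap P (x.1 + w) ≠ y.1 := fun e => hy (Subtype.ext e.symm)
    simp [this]
  · intro hh; exact absurd (Finset.mem_univ _) hh

/-- `(Y·P_w)(·, y) = Y(·, y − w)`. [folklore] -/
theorem mul_translM_apply {P : Fin (d + 1) → ℕ} (hP : ∀ i, 1 ≤ P i) (w : Fin (d + 1) → ℤ) {κ : Type*}
    (Y : Matrix κ ↥(boxDom P) ℝ) (z : κ) (y : ↥(boxDom P)) :
    (Y * translM P w (boxDom P)) z y = Y z ⟨wrap P (y.1 - w), wrap_mem_boxDom hP _⟩ := by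
  classical
  rw [Matrix.mul_apply, Finset.sum_eq_single ⟨wrap P (y.1 - w), wrap_mem_boxDom hP _⟩]
  · have h : wrap P ((⟨wrap P (y.1 - w), wrap_mem_boxDom hP _⟩ : ↥(boxDom P)).1 + w) = y.1 := by
      show wrap P (wrap P (y.1 - w) + w) = y.1
      rw [wrap_wrap_add, sub_add_cancel, wrap_eq_self y.2]
    simp only [translM_apply, h, if_true, mul_one]
  · intro l _ hl
    have : wrap P (l.1 + w) ≠ y.1 := by
      intro e
      apply hl
      apply Subtype.ext
      exact ((wrap_add_eq_iff l.2 y.2).1 e).symm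
    simp [this]
  · intro hh; exact absurd (Finset.mem_univ _) hh

/-! ### §3 The periodised adjacency and the periodic fine operator are translation-invariant -/

/-- reduction forgets period translates. [folklore] -/
theorem wrap_add_period (P : Fin (d + 1) → ℕ) (z m : Fin (d + 1) → ℤ) :
    wrap P (z + fun i => (P i : ℤ) * m i) = wrap P z := by
  funext i
  simp only [wrap, Pi.add_apply]
  exact Int.add_mul_emod_self_left _ _ _

/-- translating the centre by a period vector does not change the periodised adjacency. [folklore] -/
theorem tadj_add_period (N : Fin (d + 1) → ℕ) (u y m : Fin (d + 1) → ℤ) :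
    tadj N (u + fun i => (dbl N i : ℤ) * m i) y = tadj N u y := by
  classical
  unfold tadj
  refine Finset.card_nbij' (fun z => z - fun i => (dbl N i : ℤ) * m i) (fun z => z + fun i => (dbl N i : ℤ) * m i) ?_ ?_
    (fun z _ => sub_add_cancel _ _) (fun z _ => add_sub_cancel_right _ _)
  · intro z hz
    simp only [Finset.mem_coe, Finset.mem_filter] at hz ⊢
    refine ⟨?_, ?_⟩
    · rw [mem_nbrs_iff_sub] at hz ⊢
      rw [sub_sub, add_comm (fun i => (dbl N i : ℤ) * m i) u]
      exact hz.1
    · have h := wrap_add_period (dbl N) (z - fun i => (dbl N i : ℤ) * m i) m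
      rw [sub_add_cancel] at h
      rw [← h, hz.2]
  · intro z hz
    simp only [Finset.mem_coe, Finset.mem_filter] at hz ⊢
    refine ⟨?_, ?_⟩
    · rw [mem_nbrs_iff_sub] at hz ⊢
      rw [add_sub_add_right_eq_sub]
      exact hz.1
    · rw [wrap_add_period, hz.2]

/-- translating the centre by `w` = translating the target by `−w`. [folklore] -/
theorem tadj_add {N : Fin (d + 1) → ℕ} (u w : Fin (d + 1) → ℤ) {y : Fin (d + 1) → ℤ} (hy : y ∈ boxDom (dbl N)) :
    tadj N (u + w) y = tadj N u (wrap (dbl N) (y - w)) := by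
  classical
  unfold tadj
  refine Finset.card_nbij' (fun z => z - w) (fun z => z + w) ?_ ?_ (fun z _ => sub_add_cancel _ _)
    (fun z _ => add_sub_cancel_right _ _)
  · intro z hz
    simp only [Finset.mem_coe, Finset.mem_filter] at hz ⊢
    refine ⟨?_, ?_⟩
    · rw [mem_nbrs_iff_sub] at hz ⊢
      rw [sub_sub, add_comm w u]
      exact hz.1
    · have h := hz.2
      rw [← sub_add_cancel z w] at h
      exact (wrap_add_eq_iff' hy).1 h
  · intro z hz
    simp only [Finset.mem_coe, Finset.mem_filter] at hz ⊢
    refine ⟨?_, ?_⟩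
    · rw [mem_nbrs_iff_sub] at hz ⊢
      rw [add_sub_add_right_eq_sub]
      exact hz.1
    · exact (wrap_add_eq_iff' hy).2 hz.2

/-- **THE PERIODISED ADJACENCY IS TRANSLATION-INVARIANT**: `tadj(x + w, y) = tadj(x, y − w)` on representatives. [folklore] -/
theorem tadj_transl {N : Fin (d + 1) → ℕ} (x w : Fin (d + 1) → ℤ) {y : Fin (d + 1) → ℤ} (hy : y ∈ boxDom (dbl N)) :
    tadj N (wrap (dbl N) (x + w)) y = tadj N x (wrap (dbl N) (y - w)) := by
  have e : wrap (dbl N) (x + w) = (x + w) + fun i => (dbl N i : ℤ) * (-((x + w) i / (dbl N i : ℤ))) := by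
    funext i
    show (x + w) i % (dbl N i : ℤ) = (x + w) i + (dbl N i : ℤ) * (-((x + w) i / (dbl N i : ℤ)))
    linarith [Int.mul_ediv_add_emod ((x + w) i) (dbl N i : ℤ)]
  rw [e, tadj_add_period, tadj_add x w hy]

/-- **AT `a = 0` THE PERIODIC FINE OPERATOR COMMUTES WITH EVERY TRANSLATION**. [folklore] -/
theorem torOpK_zero_mul_translM (n : ℕ) {N : Fin (d + 1) → ℕ} (hN : ∀ i, 1 ≤ N i) (w : Fin (d + 1) → ℤ) :
    torOpK n 0 N (boxDom (dbl N)) * translM (dbl N) w (boxDom (dbl N)) =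
      translM (dbl N) w (boxDom (dbl N)) * torOpK n 0 N (boxDom (dbl N)) := by
  classical
  have hP := dbl_pos hN
  ext x y
  rw [mul_translM_apply hP, translM_mul_apply hP]
  simp only [torOpK_apply, zero_mul, ite_self, add_zero]
  rw [tadj_transl x.1 w y.2]
  have hiff : (x = ⟨wrap (dbl N) (y.1 - w), wrap_mem_boxDom hP _⟩) ↔
      ((⟨wrap (dbl N) (x.1 + w), wrap_add_mem hP x.1 w⟩ : ↥(boxDom (dbl N))) = y) := by
    rw [Subtype.ext_iff, Subtype.ext_iff]
    exact ⟨fun e => (wrap_add_eq_iff x.2 y.2).2 e.symm, fun e => ((wrap_add_eq_iff x.2 y.2).1 e).symm⟩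
  by_cases h1 : x = ⟨wrap (dbl N) (y.1 - w), wrap_mem_boxDom hP _⟩
  · rw [if_pos h1, if_pos (hiff.1 h1)]
  · rw [if_neg h1, if_neg (fun e => h1 (hiff.2 e))]

/-! ### §4 Block sums intertwine the fine translation by `L·v` with the coarse translation by `v` -/

section Blocks

variable {L : ℕ} {Nc : Fin (d + 1) → ℕ}

/-- the coarse label box of the fine representatives. [folklore] -/
theorem image_eq (hL : 1 ≤ L) (Nc : Fin (d + 1) → ℕ) :
    (boxDom (dbl fun i => L * Nc i)).image (blk L) = boxDom (dbl Nc) := image_blk_dbl hL Nc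

/-- **`S·P_{Lv} = P_v·S`**: block sums carry the fine translation by `L·v` to the coarse translation by `v`. [folklore] -/
theorem bsum_mul_translM (hL : 1 ≤ L) (hNc : ∀ i, 1 ≤ Nc i) (v : Fin (d + 1) → ℤ) :
    bsum L (boxDom (dbl fun i => L * Nc i)) * translM (dbl fun i => L * Nc i) (fun i => (L : ℤ) * v i) (boxDom (dbl fun i => L * Nc i)) =
      translM (dbl Nc) v ((boxDom (dbl fun i => L * Nc i)).image (blk L)) * bsum L (boxDom (dbl fun i => L * Nc i)) := by
  classical
  have hPf : ∀ i, 1 ≤ dbl (fun i => L * Nc i) i := dbl_pos (mul_pos_side hL hNc)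
  have hPc : ∀ i, 1 ≤ dbl Nc i := dbl_pos hNc
  have hbw : ∀ z : Fin (d + 1) → ℤ, blk L (wrap (dbl fun i => L * Nc i) z) = wrap (dbl Nc) (blk L z) := by
    intro z; rw [dbl_mul]; exact blk_wrap hL hPc z
  ext β y'
  rw [mul_translM_apply hPf, bsum_apply, Matrix.mul_apply, Finset.sum_eq_single (rblk L _ y')]
  · simp only [translM_apply, bsum_apply, if_true, mul_one]
    have e1 : (rblk L (boxDom (dbl fun i => L * Nc i)) ⟨wrap (dbl fun i => L * Nc i) (y'.1 - fun i => (L : ℤ) * v i),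
        wrap_mem_boxDom hPf _⟩ = β) ↔ wrap (dbl Nc) (blk L y'.1 - v) = β.1 := by
      rw [Subtype.ext_iff]
      show blk L (wrap (dbl fun i => L * Nc i) (y'.1 - fun i => (L : ℤ) * v i)) = β.1 ↔ _
      rw [hbw, sub_eq_add_neg, show (-fun i => (L : ℤ) * v i) = fun i => (L : ℤ) * (-v) i from by funext i; simp,
        blk_add_mul hL, ← sub_eq_add_neg]
    have e2 : (wrap (dbl Nc) (β.1 + v) = (rblk L (boxDom (dbl fun i => L * Nc i)) y').1) ↔
        wrap (dbl Nc) (blk L y'.1 - v) = β.1 := by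
      have hβ : β.1 ∈ boxDom (dbl Nc) := by rw [← image_eq hL Nc]; exact β.2
      have hy : blk L y'.1 ∈ boxDom (dbl Nc) := by rw [← image_eq hL Nc]; exact Finset.mem_image_of_mem _ y'.2
      exact wrap_add_eq_iff hβ hy
    simp only [e1]
    by_cases h : wrap (dbl Nc) (blk L y'.1 - v) = β.1
    · rw [if_pos h, if_pos (e2.2 h)]
    · rw [if_neg h, if_neg (fun e => h (e2.1 e))]
  · intro β' _ hβ'
    simp [Ne.symm hβ']
  · intro h; exact absurd (Finset.mem_univ _) h

/-- **`P_{Lv}·Sᵀ = Sᵀ·P_v`**: block-constant extension commutes with translation. [folklore] -/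
theorem translM_mul_bsum_transpose (hL : 1 ≤ L) (hNc : ∀ i, 1 ≤ Nc i) (v : Fin (d + 1) → ℤ) :
    translM (dbl fun i => L * Nc i) (fun i => (L : ℤ) * v i) (boxDom (dbl fun i => L * Nc i)) *
        (bsum L (boxDom (dbl fun i => L * Nc i)))ᵀ =
      (bsum L (boxDom (dbl fun i => L * Nc i)))ᵀ * translM (dbl Nc) v ((boxDom (dbl fun i => L * Nc i)).image (blk L)) := by
  classical
  have hPf : ∀ i, 1 ≤ dbl (fun i => L * Nc i) i := dbl_pos (mul_pos_side hL hNc)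
  have hPc : ∀ i, 1 ≤ dbl Nc i := dbl_pos hNc
  have hbw : ∀ z : Fin (d + 1) → ℤ, blk L (wrap (dbl fun i => L * Nc i) z) = wrap (dbl Nc) (blk L z) := by
    intro z; rw [dbl_mul]; exact blk_wrap hL hPc z
  ext x' β
  rw [translM_mul_apply hPf, Matrix.transpose_apply, bsum_apply, Matrix.mul_apply, Finset.sum_eq_single (rblk L _ x')]
  · simp only [Matrix.transpose_apply, bsum_apply, if_true, one_mul, translM_apply]
    have e1 : (rblk L (boxDom (dbl fun i => L * Nc i)) ⟨wrap (dbl fun i => L * Nc i) (x'.1 + fun i => (L : ℤ) * v i),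
        wrap_add_mem hPf x'.1 _⟩ = β) ↔ wrap (dbl Nc) (blk L x'.1 + v) = β.1 := by
      rw [Subtype.ext_iff]
      show blk L (wrap (dbl fun i => L * Nc i) (x'.1 + fun i => (L : ℤ) * v i)) = β.1 ↔ _
      rw [hbw, blk_add_mul hL]
    have e2 : (rblk L (boxDom (dbl fun i => L * Nc i)) x').1 = blk L x'.1 := rfl
    simp only [e1, e2]
  · intro β' _ hβ'
    simp [Matrix.transpose_apply, Ne.symm hβ']
  · intro h; exact absurd (Finset.mem_univ _) h

end Blocks

/-! ### §5 The torus line is translation-invariant at `a = 0` -/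

section Line

variable {n L : ℕ} [NeZero L] {M : Fin (d + 1) → ℕ}

/-- **AT `a = 0` THE DOUBLED-TORUS TWO-CUTOFF LINE COMMUTES WITH EVERY COARSE TRANSLATION**: `torLine(s)·P_v = P_v·torLine(s)` for all
`v ∈ ℤ^{d+1}` and all `s` — «LEMMA F» with the translation pair `(P_{Lv}, P_v)` in place of the unfold pair. [folklore] -/
theorem torLine_zero_mul_translM (hn : 1 ≤ n) (hM : ∀ i, 1 ≤ M i) (v : Fin (d + 1) → ℤ) (s : ℝ) :
    torLine (isBlockUnion_fine (fineTor_isBlockUnion hn (NeZero.one_le : 1 ≤ L) M)) n 0 (fun i => n * L * M i)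
        (fun i => n * M i) s *
      translM (dbl fun i => n * M i) v ((boxDom (dbl fun i => n * L * M i)).image (blk L)) =
    translM (dbl fun i => n * M i) v ((boxDom (dbl fun i => n * L * M i)).image (blk L)) *
      torLine (isBlockUnion_fine (fineTor_isBlockUnion hn (NeZero.one_le : 1 ≤ L) M)) n 0 (fun i => n * L * M i)
        (fun i => n * M i) s := by
  have hL : 1 ≤ L := NeZero.one_le
  have hnL : 1 ≤ n * L := NE7K1LinSchurFoldBox.one_le_mul hn hL
  have hNc : ∀ i, 1 ≤ (fun i => n * M i) i := mul_pos_side hn hM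
  have hNf : ∀ i, 1 ≤ (fun i => n * L * M i) i := mul_pos_side hnL hM
  set hT' := fineTor_isBlockUnion hn hL M
  have hLpow : ((L : ℝ) ^ (d + 1)) ≠ 0 := pow_ne_zero _ (by exact_mod_cast (NeZero.ne L))
  -- the fine intertwinings at scale L: rewrite the fine torus as `boxDom (dbl (L·(n·M)))`
  have hME := torOpK_zero_mul_translM (n * L) hNf (fun i => (L : ℤ) * v i)
  have hSE := bsum_mul_translM hL hNc v
  have hES := translM_mul_bsum_transpose hL hNc v
  rw [← side_eq n L M] at hSE hES
  -- the coarse intertwining on the label torus `boxDom (dbl (n·M))`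
  have hPE := torOpK_zero_mul_translM n hNc v
  rw [← image_fineTor hL n M] at hPE
  unfold torLine NE7K1LinTorusChart.torB
  exact lineOpR_intertwine (c := ((L : ℝ) ^ (d + 1))⁻¹) (ℓ := (L : ℝ) ^ (d + 1))
    (bsum_coordT (isBlockUnion_fine hT')) (coordT_surj (isBlockUnion_fine hT'))
    (bsum_coordT (isBlockUnion_fine hT')) (coordT_surj (isBlockUnion_fine hT')) hLpow
    (isUnit_det_torB_fluct hn hT' rfl hNf le_rfl) (isUnit_det_torB_fluct hn hT' rfl hNf le_rfl) hME hSE hES hPE s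

/-- shifted labels, as labels. [folklore] -/
theorem wrap_add_mem_image (hn : 1 ≤ n) (hM : ∀ i, 1 ≤ M i) (x v : Fin (d + 1) → ℤ) :
    wrap (dbl fun i => n * M i) (x + v) ∈ (boxDom (dbl fun i => n * L * M i)).image (blk L) := by
  rw [image_fineTor (NeZero.one_le : 1 ≤ L) n M]
  exact wrap_mem_boxDom (dbl_pos (mul_pos_side hn hM)) _

/-- **THE TORUS LINE IS A CONVOLUTION**: `T^𝕋(s)(x + v, y + v) = T^𝕋(s)(x, y)` at `a = 0`, for every translation `v` of the label torus
and every `s` — `T^𝕋(s)(x, y)` depends on `y − x (mod 2N)` only; its finite Fourier transform is the symbol `σ_s`. [folklore] -/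
theorem torLine_zero_transl_apply (hn : 1 ≤ n) (hM : ∀ i, 1 ≤ M i) (v : Fin (d + 1) → ℤ) (s : ℝ)
    (x y : ↥((boxDom (dbl fun i => n * L * M i)).image (blk L))) :
    torLine (isBlockUnion_fine (fineTor_isBlockUnion hn (NeZero.one_le : 1 ≤ L) M)) n 0 (fun i => n * L * M i)
        (fun i => n * M i) s ⟨wrap (dbl fun i => n * M i) (x.1 + v), wrap_add_mem_image hn hM x.1 v⟩
        ⟨wrap (dbl fun i => n * M i) (y.1 + v), wrap_add_mem_image hn hM y.1 v⟩ =
      torLine (isBlockUnion_fine (fineTor_isBlockUnion hn (NeZero.one_le : 1 ≤ L) M)) n 0 (fun i => n * L * M i)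
        (fun i => n * M i) s x y := by
  classical
  have hNc : ∀ i, 1 ≤ (fun i => n * M i) i := mul_pos_side hn hM
  have hP := dbl_pos hNc
  have h := torLine_zero_mul_translM hn hM v s (L := L)
  set T := torLine (isBlockUnion_fine (fineTor_isBlockUnion hn (NeZero.one_le : 1 ≤ L) M)) n 0 (fun i => n * L * M i)
    (fun i => n * M i) s with hT
  set y' : ↥((boxDom (dbl fun i => n * L * M i)).image (blk L)) :=
    ⟨wrap (dbl fun i => n * M i) (y.1 + v), wrap_add_mem_image hn hM y.1 v⟩ with hy'
  have hh := congrFun (congrFun h x) y'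
  rw [Matrix.mul_apply, Matrix.mul_apply] at hh
  -- left: the single column `l = y` (since `wrap (l + v) = wrap (y + v)` iff `l = y` on representatives)
  have hyF : y.1 ∈ boxDom (dbl fun i => n * M i) := by rw [← image_fineTor (NeZero.one_le : 1 ≤ L) n M]; exact y.2
  have hxF : x.1 ∈ boxDom (dbl fun i => n * M i) := by rw [← image_fineTor (NeZero.one_le : 1 ≤ L) n M]; exact x.2
  rw [Finset.sum_eq_single y, Finset.sum_eq_single
    (⟨wrap (dbl fun i => n * M i) (x.1 + v), wrap_add_mem_image hn hM x.1 v⟩ :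
      ↥((boxDom (dbl fun i => n * L * M i)).image (blk L)))] at hh
  · simp only [translM_apply, hy', if_true, mul_one, one_mul] at hh
    exact hh.symm
  · intro l _ hl
    have : wrap (dbl fun i => n * M i) (x.1 + v) ≠ l.1 := fun e => hl (Subtype.ext e.symm)
    simp [this]
  · intro hh'; exact absurd (Finset.mem_univ _) hh'
  · intro l _ hl
    have hlF : l.1 ∈ boxDom (dbl fun i => n * M i) := by rw [← image_fineTor (NeZero.one_le : 1 ≤ L) n M]; exact l.2
    have : wrap (dbl fun i => n * M i) (l.1 + v) ≠ y'.1 := by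
      intro e
      apply hl
      apply Subtype.ext
      rw [hy'] at e
      have e2 := (wrap_add_eq_iff' (wrap_mem_boxDom hP _)).1 e
      rw [sub_eq_add_neg, wrap_wrap_add, add_neg_cancel_right, wrap_eq_self hlF, wrap_eq_self hyF] at e2
      exact e2
    simp [this]
  · intro hh'; exact absurd (Finset.mem_univ _) hh'

end Line

end Summit.QuantumFields.BalabanUV.T4Continuum.NE7K1LinTorusLineInvariant

end
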